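import Literature.MathematicalPhysics.QuantumFieldTheory.YangMillsOS
import HarnessLib

/-!
# The clover field strength and the clover (Caracciolo–Curci–Menotti–Pelissetto) lattice stress tensor

Topic `Literature/MathematicalPhysics/QuantumFieldTheory` (definition request of the Yang–Mills crux
`CurvatureAmnesia`, line `WardDefectSketch`, card D2 "the clover field strength and the clover stress tensor as
`LocalGaugeObservable`s", and of `QCD/Theses/FourMirrorsWardE1` ("`latticeStressTensor`")).

**Sources.** I. Montvay, G. Münster, *Quantum Fields on a Lattice* (CUP 1994), eq. (5.136): the four "clover
terms" — products of the link variables along the four plaquettes touching the site `x` in a coordinate plane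
[MontvayMunster1994]. S. Caracciolo, G. Curci, P. Menotti, A. Pelissetto, *The energy–momentum tensor for lattice
gauge theories*, Ann. Phys. 197 (1990) 119, §2: the symmetric lattice energy–momentum tensor of the pure gauge
theory, discretised with a symmetric (clover) lattice field strength `F̂_μν(x)`,
`T_μν(x) = F̂_μρ F̂_νρ − ¼ δ_μν F̂_ρσ F̂_ρσ` (group trace; bare operator, to be renormalised) [CaraccioloEtAl1990].

## What is here (definitions are real; every stated property is proved)

For a lattice gauge configuration `U : LGConfig d G` on `ℤ^d` (tree `LatticeGaugeDLR`), a site `x`, a plane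
`(μ, ν)` and a matrix representation `ρ : G →* M_N(ℂ)`:
* `cloverLeaf U x μ ν q` (`q : Fin 4`) — the holonomies of the four plaquettes of the `(μ, ν)` plane touching
  `x`, all BASED AT `x` (leaf `0` is the tree's `plaquetteHolonomyZd U x μ ν`; leaves `1, 2, 3` are the
  plaquettes at `x − e_μ`, `x − e_μ − e_ν`, `x − e_ν` parallel-transported to `x`), so that each transforms by
  conjugation with `g x` under a lattice gauge transformation (`cloverLeaf_gaugeTransformZd`);
* `cloverSum ρ U x μ ν = Σ_q ρ(cloverLeaf …)` (Montvay–Münster's `Q_μν(x)`) and the **clover field strength**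
  `cloverFieldStrength ρ U x μ ν = ⅛ (Q_μν − Q_μνᴴ)` — skew-Hermitian (`conjTranspose_cloverFieldStrength`),
  gauge-covariant for unitary `ρ` (`cloverFieldStrength_gaugeTransformZd`), classically `a² ρ_*(F_μν(x)) + O(a⁴)`;
* the **clover stress density** `cloverStressDensity ρ U x μ ν = −Σ_λ Re tr(F̂_μλ F̂_νλ) + ¼ δ_μν Σ_{λσ} Re tr(F̂_λσ F̂_λσ)`
  (real, symmetric in `(μ, ν)`: `cloverStressDensity_symm`; traceless in four dimensions:
  `sum_cloverStressDensity_diag`; gauge INVARIANT for unitary `ρ`: `isZdGaugeInvariant_cloverStressDensity`);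
* translation covariance of all three (`cloverLeaf_configShift`, …), and, for a lattice representation
  `r : LatticeRep G` of a compact group in `d = 4`, the packaging of the stress density at the origin as a
  species of the Yang–Mills OS data, `LatticeRep.cloverStress r μ ν : YMSpecies G` (a bounded measurable
  gauge-invariant cylinder function, like `LatticeRep.curvature`).

## Deliberately NOT here
The projection of `F̂` onto the Lie algebra `ρ_*(𝔤) = repLieAlgebra r` (for `SU(N)` the traceless part; needed
when `F̂` is used as a Schwinger–Dyson direction), the `O(a)`-improvement / renormalisation constants of CCMP §§3–4,
and any Ward identity: this file only supplies the bare local observables.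
-/

noncomputable section

open scoped BigOperators Matrix
open Literature.Probability Literature.Probability.LatticeModels Literature.MathematicalPhysics.QuantumLattice

namespace Literature.MathematicalPhysics.QuantumFieldTheory

variable {d N : ℕ} {G : Type*} [Group G]

/-! ### The four clover leaves -/

/-- The **four clover leaves** at `x` in the `(μ, ν)` plane, as group elements based at `x`:
leaf `0` is the plaquette holonomy `U(x,μ)U(x+e_μ,ν)U(x+e_ν,μ)⁻¹U(x,ν)⁻¹`; leaf `1` is the plaquette at
`x − e_μ` transported to `x` along the link `(x − e_μ, μ)`; leaf `2` the plaquette at `x − e_μ − e_ν` transported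
along `(x−e_μ−e_ν, μ)(x−e_ν, ν)`; leaf `3` the plaquette at `x − e_ν` transported along `(x − e_ν, ν)` — the four
"clover terms" of Montvay–Münster (5.136) (there written for the links `U_{xk}`; unwinding the transports
gives their products `U_ν(x)U_μ(x−μ+ν)†U_ν(x−μ)†U_μ(x−μ)` etc. for unitary links). [cite: MontvayMunster1994, (5.136)] -/
def cloverLeaf (U : LGConfig d G) (x : LatticeModels.Site d) (μ ν : Fin d) : Fin 4 → G :=
  ![plaquetteHolonomyZd U x μ ν,
    (U (x - Pi.single μ 1, μ))⁻¹ * plaquetteHolonomyZd U (x - Pi.single μ 1) μ ν * U (x - Pi.single μ 1, μ),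
    (U (x - Pi.single μ 1 - Pi.single ν 1, μ) * U (x - Pi.single ν 1, ν))⁻¹ *
        plaquetteHolonomyZd U (x - Pi.single μ 1 - Pi.single ν 1) μ ν *
      (U (x - Pi.single μ 1 - Pi.single ν 1, μ) * U (x - Pi.single ν 1, ν)),
    (U (x - Pi.single ν 1, ν))⁻¹ * plaquetteHolonomyZd U (x - Pi.single ν 1) μ ν * U (x - Pi.single ν 1, ν)]

/-- Leaf `0` is the plaquette holonomy based at `x`. [folklore] -/
@[simp] theorem cloverLeaf_zero (U : LGConfig d G) (x : LatticeModels.Site d) (μ ν : Fin d) :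
    cloverLeaf U x μ ν 0 = plaquetteHolonomyZd U x μ ν := rfl

/-- **Gauge covariance of the leaves**: under `U ↦ U^g` every clover leaf at `x` is conjugated by `g x`
(each is a closed loop based at `x`). [folklore] -/
theorem cloverLeaf_gaugeTransformZd (g : LatticeModels.Site d → G) (U : LGConfig d G) (x : LatticeModels.Site d) (μ ν : Fin d)
    (q : Fin 4) : cloverLeaf (gaugeTransformZd g U) x μ ν q = g x * cloverLeaf U x μ ν q * (g x)⁻¹ := by
  have hlink : ∀ (y : LatticeModels.Site d) (i : Fin d),
      gaugeTransformZd g U (y, i) = g y * U (y, i) * (g (y + Pi.single i 1))⁻¹ := fun y i => rfl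
  fin_cases q
  · exact plaquetteHolonomyZd_gaugeTransformZd g U x μ ν
  · simp only [cloverLeaf, Fin.mk_one, Matrix.cons_val_one, Matrix.cons_val_zero,
      plaquetteHolonomyZd_gaugeTransformZd, hlink, sub_add_cancel, mul_inv_rev, inv_inv]
    group
  · simp only [cloverLeaf, Fin.reduceFinMk, Matrix.cons_val, plaquetteHolonomyZd_gaugeTransformZd, hlink,
      sub_add_cancel, mul_inv_rev, inv_inv, show x - Pi.single μ 1 - Pi.single ν 1 + Pi.single μ 1 =
        x - Pi.single ν 1 by abel]
    group
  · simp only [cloverLeaf, Fin.reduceFinMk, Matrix.cons_val, plaquetteHolonomyZd_gaugeTransformZd, hlink,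
      sub_add_cancel, mul_inv_rev, inv_inv]
    group

section Shift

variable [MeasurableSpace G]

omit [Group G] in
/-- Auxiliary: the shifted configuration evaluated. [folklore] -/
private theorem configShift_apply' (v : LatticeModels.Site d) (U : LGConfig d G) (y : LatticeModels.Site d) (i : Fin d) :
    configShift v U (y, i) = U (y - v, i) := configShift_apply v U (y, i)

/-- Plaquette holonomies of a shifted configuration (`ℤ^d` version of `plaquetteHolonomy_torusConfigShift`). [folklore] -/
theorem plaquetteHolonomyZd_configShift (v : LatticeModels.Site d) (U : LGConfig d G) (x : LatticeModels.Site d) (μ ν : Fin d) :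
    plaquetteHolonomyZd (configShift v U) x μ ν = plaquetteHolonomyZd U (x - v) μ ν := by
  simp only [plaquetteHolonomyZd, configShift_apply', add_sub_right_comm]

/-- **Translation covariance of the leaves**: the leaves of the shifted configuration at `x` are the leaves
at `x − v`. [folklore] -/
theorem cloverLeaf_configShift (v : LatticeModels.Site d) (U : LGConfig d G) (x : LatticeModels.Site d) (μ ν : Fin d) (q : Fin 4) :
    cloverLeaf (configShift v U) x μ ν q = cloverLeaf U (x - v) μ ν q := by
  fin_cases q <;>
    simp only [cloverLeaf, Fin.zero_eta, Fin.mk_one, Fin.reduceFinMk, Matrix.cons_val_zero,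
      Matrix.cons_val_one, Matrix.cons_val, plaquetteHolonomyZd_configShift, configShift_apply',
      sub_right_comm _ v]

end Shift

/-! ### The clover sum and the clover field strength -/

variable (ρ : G →* Matrix (Fin N) (Fin N) ℂ)

/-- The **clover sum** `Q_μν(x) = Σ_{q<4} ρ(leaf_q)` in the representation `ρ`. [cite: MontvayMunster1994, (5.136)] -/
def cloverSum (U : LGConfig d G) (x : LatticeModels.Site d) (μ ν : Fin d) : Matrix (Fin N) (Fin N) ℂ :=
  ∑ q : Fin 4, ρ (cloverLeaf U x μ ν q)

/-- The **clover field strength** `F̂_μν(x) = ⅛ (Q_μν(x) − Q_μν(x)ᴴ)`, the skew-Hermitian part of the averaged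
clover sum (classically `a² ρ_*(F_μν(x)) + O(a⁴)`; for `SU(N)` CCMP additionally remove the trace, which is the
projection onto `𝔰𝔲(N)` — not done here, see the module docstring). [cite: CaraccioloEtAl1990, §2] -/
def cloverFieldStrength (U : LGConfig d G) (x : LatticeModels.Site d) (μ ν : Fin d) : Matrix (Fin N) (Fin N) ℂ :=
  (8 : ℂ)⁻¹ • (cloverSum ρ U x μ ν - (cloverSum ρ U x μ ν)ᴴ)

/-- The clover field strength is skew-Hermitian, `F̂ᴴ = −F̂`. [folklore] -/
theorem conjTranspose_cloverFieldStrength (U : LGConfig d G) (x : LatticeModels.Site d) (μ ν : Fin d) :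
    (cloverFieldStrength ρ U x μ ν)ᴴ = -cloverFieldStrength ρ U x μ ν := by
  have h8 : star ((8 : ℂ)⁻¹) = (8 : ℂ)⁻¹ := by norm_num [star_inv₀]
  simp only [cloverFieldStrength, Matrix.conjTranspose_smul, Matrix.conjTranspose_sub,
    Matrix.conjTranspose_conjTranspose, h8, ← smul_neg, neg_sub]

/-- Translation covariance of the clover sum. [folklore] -/
theorem cloverSum_configShift [MeasurableSpace G] (v : LatticeModels.Site d) (U : LGConfig d G) (x : LatticeModels.Site d) (μ ν : Fin d) :
    cloverSum ρ (configShift v U) x μ ν = cloverSum ρ U (x - v) μ ν := by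
  simp only [cloverSum, cloverLeaf_configShift]

/-- Translation covariance of the clover field strength. [folklore] -/
theorem cloverFieldStrength_configShift [MeasurableSpace G] (v : LatticeModels.Site d) (U : LGConfig d G) (x : LatticeModels.Site d)
    (μ ν : Fin d) : cloverFieldStrength ρ (configShift v U) x μ ν = cloverFieldStrength ρ U (x - v) μ ν := by
  simp only [cloverFieldStrength, cloverSum_configShift]

section Unitary

variable {ρ}

/-- For a unitary-valued representation, `ρ(h)ᴴ = ρ(h⁻¹)`. [folklore] -/
theorem conjTranspose_eq_map_inv (hρu : ∀ g, ρ g ∈ Matrix.unitaryGroup (Fin N) ℂ) (h : G) :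
    (ρ h)ᴴ = ρ h⁻¹ := by
  have h1 : ρ h⁻¹ * ρ h = 1 := by rw [← map_mul, inv_mul_cancel, map_one]
  have h2 : ρ h * star (ρ h) = 1 := Matrix.mem_unitaryGroup_iff.1 (hρu h)
  calc (ρ h)ᴴ = ρ h⁻¹ * ρ h * star (ρ h) := by rw [h1, one_mul]; rfl
    _ = ρ h⁻¹ := by rw [mul_assoc, h2, mul_one]

/-- **Gauge covariance of the clover sum**: `Q_μν(x)(U^g) = ρ(g x) Q_μν(x)(U) ρ(g x)⁻¹`. [folklore] -/
theorem cloverSum_gaugeTransformZd (g : LatticeModels.Site d → G) (U : LGConfig d G) (x : LatticeModels.Site d) (μ ν : Fin d) :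
    cloverSum ρ (gaugeTransformZd g U) x μ ν = ρ (g x) * cloverSum ρ U x μ ν * ρ (g x)⁻¹ := by
  simp only [cloverSum, cloverLeaf_gaugeTransformZd, map_mul, Finset.mul_sum, Finset.sum_mul]

/-- **Gauge covariance of the clover field strength** (unitary `ρ`):
`F̂_μν(x)(U^g) = ρ(g x) F̂_μν(x)(U) ρ(g x)⁻¹`. [cite: CaraccioloEtAl1990, §2] -/
theorem cloverFieldStrength_gaugeTransformZd (hρu : ∀ g, ρ g ∈ Matrix.unitaryGroup (Fin N) ℂ)
    (g : LatticeModels.Site d → G) (U : LGConfig d G) (x : LatticeModels.Site d) (μ ν : Fin d) :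
    cloverFieldStrength ρ (gaugeTransformZd g U) x μ ν =
      ρ (g x) * cloverFieldStrength ρ U x μ ν * ρ (g x)⁻¹ := by
  simp only [cloverFieldStrength, cloverSum_gaugeTransformZd, Matrix.conjTranspose_mul,
    conjTranspose_eq_map_inv hρu, inv_inv, Matrix.smul_mul, Matrix.mul_smul, mul_sub, sub_mul, mul_assoc]

end Unitary

/-! ### The clover stress density -/

/-- The **clover stress density** (bare symmetric lattice energy–momentum tensor of the pure gauge theory,
CCMP): `T_μν(x) = −Σ_λ Re tr(F̂_μλ F̂_νλ) + ¼ δ_μν Σ_{λ,σ} Re tr(F̂_λσ F̂_λσ)` with the clover field strength `F̂`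
(skew-Hermitian, so `−Re tr(F̂F̂) = Re tr(F̂ F̂ᴴ) ≥ 0` on the diagonal `μ = ν = λ`-terms; continuum
`F_μλ F_νλ − ¼ δ_μν F²` up to the factor `a⁴/g₀²` and renormalisation). [cite: CaraccioloEtAl1990, §2] -/
def cloverStressDensity (U : LGConfig d G) (x : LatticeModels.Site d) (μ ν : Fin d) : ℝ :=
  -(∑ l : Fin d, (cloverFieldStrength ρ U x μ l * cloverFieldStrength ρ U x ν l).trace.re) +
    if μ = ν then
      (4 : ℝ)⁻¹ * ∑ l : Fin d, ∑ s : Fin d, (cloverFieldStrength ρ U x l s * cloverFieldStrength ρ U x l s).trace.re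
    else 0

/-- The stress density is symmetric in `(μ, ν)` (cyclicity of the trace). [cite: CaraccioloEtAl1990, §2] -/
theorem cloverStressDensity_symm (U : LGConfig d G) (x : LatticeModels.Site d) (μ ν : Fin d) :
    cloverStressDensity ρ U x μ ν = cloverStressDensity ρ U x ν μ := by
  unfold cloverStressDensity
  congr 1
  · simp only [Matrix.trace_mul_comm (cloverFieldStrength ρ U x μ _)]
  · by_cases h : μ = ν
    · subst h; rfl
    · rw [if_neg h, if_neg (Ne.symm h)]

/-- In four dimensions the stress density is traceless: `Σ_μ T_μμ = 0`. [cite: CaraccioloEtAl1990, §2] -/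
theorem sum_cloverStressDensity_diag (U : LGConfig 4 G) (x : LatticeModels.Site 4) :
    ∑ μ : Fin 4, cloverStressDensity ρ U x μ μ = 0 := by
  simp only [cloverStressDensity, if_true, Finset.sum_add_distrib, Finset.sum_neg_distrib, Finset.sum_const,
    Finset.card_univ, Fintype.card_fin, nsmul_eq_mul]
  push_cast
  ring

/-- Translation covariance of the stress density: `T_μν(x)(θ_v U) = T_μν(x − v)(U)`. [folklore] -/
theorem cloverStressDensity_configShift [MeasurableSpace G] (v : LatticeModels.Site d) (U : LGConfig d G) (x : LatticeModels.Site d)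
    (μ ν : Fin d) : cloverStressDensity ρ (configShift v U) x μ ν = cloverStressDensity ρ U (x - v) μ ν := by
  simp only [cloverStressDensity, cloverFieldStrength_configShift]

/-- **Gauge invariance of the stress density** (unitary `ρ`): traces of products of covariant fields. [cite: CaraccioloEtAl1990, §2] -/
theorem isZdGaugeInvariant_cloverStressDensity {ρ : G →* Matrix (Fin N) (Fin N) ℂ}
    (hρu : ∀ g, ρ g ∈ Matrix.unitaryGroup (Fin N) ℂ) (x : LatticeModels.Site d) (μ ν : Fin d) :
    IsZdGaugeInvariant fun U : LGConfig d G => cloverStressDensity ρ U x μ ν := by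
  intro g U
  have htr : ∀ a b c e : Fin d,
      (cloverFieldStrength ρ (gaugeTransformZd g U) x a b * cloverFieldStrength ρ (gaugeTransformZd g U) x c e).trace
        = (cloverFieldStrength ρ U x a b * cloverFieldStrength ρ U x c e).trace := by
    intro a b c e
    simp only [cloverFieldStrength_gaugeTransformZd hρu]
    have hinv : ρ (g x)⁻¹ * ρ (g x) = 1 := by rw [← map_mul, inv_mul_cancel, map_one]
    rw [show ρ (g x) * cloverFieldStrength ρ U x a b * ρ (g x)⁻¹ * (ρ (g x) * cloverFieldStrength ρ U x c e * ρ (g x)⁻¹)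
        = ρ (g x) * (cloverFieldStrength ρ U x a b * cloverFieldStrength ρ U x c e * ρ (g x)⁻¹) by
          simp only [mul_assoc, ← mul_assoc (ρ (g x)⁻¹) (ρ (g x)), hinv, one_mul],
      Matrix.trace_mul_comm, mul_assoc, hinv, mul_one]
  simp only [cloverStressDensity, htr]

/-! ### Cylinder property: the clover observables at the origin depend on finitely many links -/

/-- The edges within `ℓ^∞`-distance `2` of the origin: a finite set carrying every clover leaf at `0`. [folklore] -/
def cloverSupport (d : ℕ) : Finset (ZdEdge d) := box d 2 ×ˢ Finset.univ

/-- `±e_μ`, `±e_μ ± e_ν` (and `0`) lie in the box of radius `2`. [folklore] -/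
theorem mem_box_two_of_abs_le {y : LatticeModels.Site d} (h : ∀ i, |y i| ≤ 2) : y ∈ box d 2 := by
  rw [mem_box]
  intro i
  have := h i
  constructor <;> · push_cast; linarith [abs_le.1 this]

/-- Coordinates of `c • e_μ`-combinations are small: `|(a e_μ + b e_ν) i| ≤ |a| + |b|`. [folklore] -/
theorem abs_single_add_single_le (μ ν : Fin d) (a b : ℤ) (i : Fin d) :
    |(Pi.single μ a + Pi.single ν b : LatticeModels.Site d) i| ≤ |a| + |b| := by
  simp only [Pi.add_apply, Pi.single_apply]
  split_ifs <;> simp [abs_add_le, abs_nonneg, add_nonneg]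

/-- Every site of the form `0 + a e_μ + b e_ν` with `|a|,|b| ≤ 1` is in `box d 2`. [folklore] -/
theorem single_add_single_mem_box_two (μ ν : Fin d) {a b : ℤ} (ha : |a| ≤ 1) (hb : |b| ≤ 1) :
    (Pi.single μ a + Pi.single ν b : LatticeModels.Site d) ∈ box d 2 :=
  mem_box_two_of_abs_le fun i => (abs_single_add_single_le μ ν a b i).trans (by linarith)

/-- **Locality of the leaves**: the leaves at the origin only read links whose base point lies in the
`ℓ^∞`-ball of radius `2`. [folklore] -/
theorem cloverLeaf_eq_of_forall {U V : LGConfig d G}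
    (h : ∀ y : LatticeModels.Site d, (∀ j, |y j| ≤ 2) → ∀ i, U (y, i) = V (y, i)) (μ ν : Fin d) (q : Fin 4) :
    cloverLeaf U 0 μ ν q = cloverLeaf V 0 μ ν q := by
  fin_cases q <;>
    simp (disch := intro j; simp only [Pi.add_apply, Pi.sub_apply, Pi.zero_apply, Pi.single_apply] <;>
        first | (split_ifs <;> norm_num) | norm_num) only
      [cloverLeaf, plaquetteHolonomyZd, Fin.zero_eta, Fin.mk_one, Fin.reduceFinMk, Matrix.cons_val_zero,
        Matrix.cons_val_one, Matrix.cons_val, h]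

/-- **The leaves at the origin are cylinder functions of `cloverSupport`.** [folklore] -/
theorem cloverLeaf_eq_of_eqOn {U V : LGConfig d G} (h : ∀ e ∈ cloverSupport d, U e = V e) (μ ν : Fin d)
    (q : Fin 4) : cloverLeaf U 0 μ ν q = cloverLeaf V 0 μ ν q :=
  cloverLeaf_eq_of_forall (fun _ hy _ =>
    h _ (Finset.mem_product.2 ⟨mem_box_two_of_abs_le hy, Finset.mem_univ _⟩)) μ ν q

/-- The stress density at the origin is a cylinder function of `cloverSupport`. [folklore] -/
theorem isCylinder_cloverStressDensity_zero (μ ν : Fin d) :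
    IsCylinder (fun U : LGConfig d G => cloverStressDensity ρ U 0 μ ν) (cloverSupport d) := by
  intro U V h
  have hF : ∀ a b : Fin d, cloverFieldStrength ρ U 0 a b = cloverFieldStrength ρ V 0 a b := fun a b => by
    simp only [cloverFieldStrength, cloverSum, cloverLeaf_eq_of_eqOn (fun e he => h e he)]
  simp only [cloverStressDensity, hF]

/-! ### Relation to the plaquette observables -/

/-- The trace of a conjugate: `tr(ρ(h⁻¹) A ρ(h)) = tr A`. [folklore] -/
theorem trace_map_inv_mul_mul_map (h : G) (A : Matrix (Fin N) (Fin N) ℂ) :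
    (ρ h⁻¹ * A * ρ h).trace = A.trace := by
  rw [Matrix.trace_mul_cycle, ← map_mul, mul_inv_cancel, map_one, one_mul]

/-- The character of a conjugate: `tr ρ(h⁻¹ a h) = tr ρ(a)`. [folklore] -/
theorem trace_map_conj (h a : G) : (ρ (h⁻¹ * a * h)).trace = (ρ a).trace := by
  rw [map_mul, map_mul, trace_map_inv_mul_mul_map]

/-- **`Re tr Q_μν(x)` is the sum of the four plaquette observables around `x`** in the `(μ, ν)` plane
(the transports drop out of the trace): the clover sum refines, and its real trace reduces to, the tree's
`plaquetteObs`. [cite: MontvayMunster1994, (5.136)] -/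
theorem re_trace_cloverSum [MeasurableSpace G] (U : LGConfig d G) (x : LatticeModels.Site d) (μ ν : Fin d) :
    (cloverSum ρ U x μ ν).trace.re =
      plaquetteObs ρ x μ ν U + plaquetteObs ρ (x - Pi.single μ 1) μ ν U +
        plaquetteObs ρ (x - Pi.single μ 1 - Pi.single ν 1) μ ν U + plaquetteObs ρ (x - Pi.single ν 1) μ ν U := by
  simp only [cloverSum, Fin.sum_univ_four, cloverLeaf, Matrix.cons_val_zero, Matrix.cons_val_one,
    Matrix.cons_val, Matrix.trace_add, Complex.add_re, trace_map_conj, plaquetteObs]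

/-! ### Continuity, boundedness, measurability; the stress density as a species of the Yang–Mills OS data -/

section Continuity

variable [TopologicalSpace G] [IsTopologicalGroup G]

/-- Each clover leaf is a continuous function of the configuration (product topology). [folklore] -/
theorem continuous_cloverLeaf (x : LatticeModels.Site d) (μ ν : Fin d) (q : Fin 4) :
    Continuous fun U : LGConfig d G => cloverLeaf U x μ ν q := by
  fin_cases q <;>
    simp only [cloverLeaf, plaquetteHolonomyZd, Fin.zero_eta, Fin.mk_one, Fin.reduceFinMk, Matrix.cons_val_zero,
      Matrix.cons_val_one, Matrix.cons_val] <;>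
    fun_prop

/-- The clover field strength of a continuous representation is continuous in the configuration. [folklore] -/
theorem continuous_cloverFieldStrength (hρ : Continuous ρ) (x : LatticeModels.Site d) (μ ν : Fin d) :
    Continuous fun U : LGConfig d G => cloverFieldStrength ρ U x μ ν := by
  have hQ : Continuous fun U : LGConfig d G => cloverSum ρ U x μ ν :=
    continuous_finsetSum _ fun q _ => hρ.comp (continuous_cloverLeaf x μ ν q)
  unfold cloverFieldStrength
  exact (hQ.sub hQ.matrix_conjTranspose).const_smul ((8 : ℂ)⁻¹)

/-- The clover stress density of a continuous representation is continuous in the configuration. [folklore] -/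
theorem continuous_cloverStressDensity (hρ : Continuous ρ) (x : LatticeModels.Site d) (μ ν : Fin d) :
    Continuous fun U : LGConfig d G => cloverStressDensity ρ U x μ ν := by
  have htr : ∀ a b c e : Fin d, Continuous fun U : LGConfig d G =>
      (cloverFieldStrength ρ U x a b * cloverFieldStrength ρ U x c e).trace.re := fun a b c e =>
    Complex.continuous_re.comp (((continuous_cloverFieldStrength ρ hρ x a b).mul
      (continuous_cloverFieldStrength ρ hρ x c e)).matrix_trace)
  unfold cloverStressDensity
  refine ((continuous_finsetSum _ fun l _ => htr μ l ν l).neg).add ?_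
  split_ifs
  · exact continuous_const.mul (continuous_finsetSum _ fun l _ => continuous_finsetSum _ fun s _ => htr l s l s)
  · exact continuous_const

/-- On a compact group the stress density of a continuous representation is bounded. [folklore] -/
theorem exists_abs_cloverStressDensity_le [CompactSpace G] (hρ : Continuous ρ) (x : LatticeModels.Site d)
    (μ ν : Fin d) : ∃ C, ∀ U : LGConfig d G, |cloverStressDensity ρ U x μ ν| ≤ C := by
  obtain ⟨C, hC⟩ := (isCompact_univ.image
    (continuous_abs.comp (continuous_cloverStressDensity ρ hρ x μ ν))).isBounded.bddAbove
  exact ⟨C, fun U => hC ⟨U, Set.mem_univ _, rfl⟩⟩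

/-- With a second-countable Borel structure on `G` the stress density is measurable. [folklore] -/
theorem measurable_cloverStressDensity [MeasurableSpace G] [BorelSpace G] [SecondCountableTopology G]
    (hρ : Continuous ρ) (x : LatticeModels.Site d) (μ ν : Fin d) :
    Measurable fun U : LGConfig d G => cloverStressDensity ρ U x μ ν :=
  (continuous_cloverStressDensity ρ hρ x μ ν).measurable

end Continuity

section Species

variable {G₀ : Type} [Group G₀] [TopologicalSpace G₀] [IsTopologicalGroup G₀] [CompactSpace G₀]
  [MeasurableSpace G₀] [BorelSpace G₀]

/-- **The clover stress tensor as species of the Yang–Mills OS data**: for a lattice representation `r` of a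
compact group `G` (`d = 4`), the `(μ, ν)` component of the clover stress density AT THE ORIGIN is a bounded,
measurable, gauge-invariant cylinder function of the lattice gauge field — a `LocalGaugeObservable`, i.e. a
species `YMSpecies G` whose renormalised smeared translates enter `latticeSchwinger` like the curvature species
`r.curvature` (second countability of `G` from the closed embedding `r.ρ`, as for `LatticeRep.curvature`).
[cite: CaraccioloEtAl1990, §2] -/
def LatticeRep.cloverStress (r : LatticeRep G₀) (μ ν : Fin 4) : YMSpecies G₀ :=
  haveI : SecondCountableTopology G₀ :=
    (r.continuous.isClosedEmbedding r.injective).isEmbedding.secondCountableTopology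
  { F := fun U => cloverStressDensity r.ρ U 0 μ ν
    supp := cloverSupport 4
    isCylinder := isCylinder_cloverStressDensity_zero r.ρ μ ν
    gaugeInvariant := isZdGaugeInvariant_cloverStressDensity r.mem_unitary 0 μ ν
    bounded := exists_abs_cloverStressDensity_le r.ρ r.continuous 0 μ ν
    measurable := measurable_cloverStressDensity r.ρ r.continuous 0 μ ν }

/-- The underlying function of the species `r.cloverStress μ ν`. [folklore] -/
@[simp] theorem LatticeRep.cloverStress_F (r : LatticeRep G₀) (μ ν : Fin 4) (U : LGConfig 4 G₀) :
    (r.cloverStress μ ν).F U = cloverStressDensity r.ρ U 0 μ ν := rfl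

/-- The species are symmetric in `(μ, ν)` and traceless (as functions). [cite: CaraccioloEtAl1990, §2] -/
theorem LatticeRep.cloverStress_symm_and_trace (r : LatticeRep G₀) (U : LGConfig 4 G₀) :
    (∀ μ ν : Fin 4, (r.cloverStress μ ν).F U = (r.cloverStress ν μ).F U) ∧
      ∑ μ : Fin 4, (r.cloverStress μ μ).F U = 0 :=
  ⟨fun μ ν => cloverStressDensity_symm r.ρ U 0 μ ν, sum_cloverStressDensity_diag r.ρ U 0⟩

end Species

end Literature.MathematicalPhysics.QuantumFieldTheory

end
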